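import Literature.AnabelianGeometry.SemiGraphs.TemperedCyclotomic
import Literature.AnabelianGeometry.EtaleTheta.CyclotomeZHatEquiv
import HarnessLib

/-!
# [EtTh] §1 p. 12 «`Ẑ(1)`»: a Tate-twist CRITERION from cyclotomically equivariant level maps —
# `IsTateTwist` from a compatible, jointly injective family of open-kernel surjections `T ↠ ℤ/N` on which
# `Π^tp_X` acts THROUGH THE CYCLOTOMIC CHARACTER (proof-only, any field of characteristic `0`)

S. Mochizuki, *The étale theta function and its Frobenioid-theoretic manifestations*, Publ. RIMS **45** (2009)
[EtTh], §1, PRIMS PDF p. 12 (printed p. 238): «`1 → Ẑ(1) → Δ^ell_X → Ẑ → 1` … `(Ẑ(1) ≅) Δ_Θ` … Thus,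
`(Δ^tp_Y)^ell ≅ Ẑ(1)`» [cite: MochizukiEtTh2009, §1 p.12] — `Ẑ(1) = lim_n μ_n(K̄)` as a `G_K`-MODULE, typed by
abc-iut-L3 (`SemiGraphs/TemperedCyclotomic.lean`) as `OncePuncturedTemperedGroup.IsTateTwist` (compatible,
jointly injective, continuous surjections `T ↠ μ_n(K̄)`, `Π^tp_X`-equivariant for `G_K` acting on `μ_n(K̄) ⊆ K̄`;
the common body of the FACT-LIST rows F-0657 / F-0658 / F-0659 / F-1697).

Cell abc-iut, layer L2, seat abc-iut-L2-t7 (gen 4), row «P12-PACKAGE@χ-BRIDGE», file 1 of 2.  PROOF-ONLY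
(0 definitions, no instance, no `Prop` fact).  abc-iut-f-172's kernel locus `Sec1CyclotomicPackageGaloisLocus`
(p443083) constructs the Tate-twist structure from an abstract `T ≃* Ẑ` when `Π^tp_X` acts TRIVIALLY on
`Δ^ell_X`, where equivariance degenerates to «`G_K` fixes `μ_∞(K̄)`» — false over every `p`-adic field.  Here the
same construction (`t ↦ ξ_N ^ λ_N(t)` for a compatible system `ξ` of primitive roots of unity, abc-iut-w4-d024 /
w5-d091's `cyclotome.exists_generator`) is run for an ARBITRARY action, isolating what a TWISTED datum must supply:

* **`OncePuncturedTemperedGroup.isTateTwist_of_cyclotomicLevels`** — for `D : OncePuncturedTemperedGroup K`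
  (`K` of characteristic `0`), a subgroup `T ≤ A` stable under an action `act` of `Π^tp_X`, and homomorphisms
  `λ_N : T → ℤ/N` (`N ≥ 1`) that are SURJECTIVE, with OPEN kernels, COMPATIBLE (`λ_{NM} mod N = λ_N`), JOINTLY
  INJECTIVE, and CYCLOTOMICALLY EQUIVARIANT — «`λ_N(g · t) = k · λ_N(t)` whenever `aug g ∈ Gal(K̄/K)` acts on
  `μ_N(K̄)` as `ζ ↦ ζ^k`» — `T` IS a Tate twist `Ẑ(1)`: `D.IsTateTwist T act hact`.
* `OncePuncturedTemperedGroup.exists_pow_eq_galApply_of_pow_eq_one` — bookkeeping used inside and by file 2: every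
  `σ ∈ Gal(K̄/K)` acts on `μ_N(K̄)` as SOME power map `ζ ↦ ζ^k` (`μ_N(K̄)` is cyclic, generated by a primitive root);
  `OncePuncturedTemperedGroup.pow_eq_pow_of_forall_rootsOfUnity` — two such exponents agree modulo `N`.

So, in the kernel, a datum carries the typed «`(Δ^tp_Y)^ell ≅ Ẑ(1)`» as soon as it exhibits level maps on which
`Π^tp_X` acts through the mod-`N` cyclotomic characters of `aug` — which file 2 does at the χ-twisted model.
HONEST FRAMING: statements about OUR typed predicate on abstract data; [EtTh] is refereed, nothing of it is asserted;
no side taken on [IUTchIII] Cor. 3.12; typed ≠ proved.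
-/

noncomputable section

namespace Literature.AnabelianGeometry.SemiGraphs

namespace OncePuncturedTemperedGroup

open Literature.AnabelianGeometry.EtaleTheta
open _root_.Topology

variable {K : Type} [Field K] (D : OncePuncturedTemperedGroup K)

/-- **Every `σ ∈ Gal(K̄/K)` acts on `μ_N(K̄)` as a power map** (`K` of characteristic `0`): there is `k < N` with
`σ ζ = ζ^k` for every `N`-th root of unity `ζ ∈ K̄` (`μ_N(K̄)` is cyclic on a primitive root `ξ_N`, and
`σ ξ_N ∈ μ_N(K̄)`). [cite: MochizukiEtTh2009, §1 p.13] -/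
theorem exists_pow_eq_galApply_of_pow_eq_one [CharZero K] (σ : Field.absoluteGaloisGroup K) (N : ℕ+) :
    ∃ k : ℕ, k < N ∧ ∀ ζ : (AlgebraicClosure K)ˣ, ζ ^ (N : ℕ) = 1 →
      galApply σ (ζ : AlgebraicClosure K) = ((ζ ^ k : (AlgebraicClosure K)ˣ) : AlgebraicClosure K) := by
  haveI : CharZero (AlgebraicClosure K) :=
    charZero_of_injective_algebraMap (algebraMap K (AlgebraicClosure K)).injective
  haveI : NeZero (N : ℕ) := ⟨N.ne_zero⟩
  obtain ⟨ξ₀, hξ₀⟩ := cyclotome.exists_isPrimitiveRoot_of_isSepClosed (AlgebraicClosure K) N N.pos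
  have hξu : IsUnit ξ₀ := hξ₀.isUnit N.ne_zero
  set ξ : (AlgebraicClosure K)ˣ := hξu.unit with hξdef
  have hξ : IsPrimitiveRoot ξ (N : ℕ) := by
    rw [← IsPrimitiveRoot.coe_units_iff, hξu.unit_spec]
    exact hξ₀
  -- `σ` on the unit group (on underlying elements it is `galApply σ`, by `rfl`)
  let σu : (AlgebraicClosure K)ˣ →* (AlgebraicClosure K)ˣ :=
    Units.map ((show AlgebraicClosure K ≃ₐ[K] AlgebraicClosure K from σ) :
      AlgebraicClosure K →* AlgebraicClosure K)
  have hσu : ∀ u : (AlgebraicClosure K)ˣ,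
      ((σu u : (AlgebraicClosure K)ˣ) : AlgebraicClosure K) = galApply σ (u : AlgebraicClosure K) := fun _ => rfl
  -- `σ ξ ∈ μ_N`, hence a power of `ξ`
  have hσξ : σu ξ ∈ rootsOfUnity N (AlgebraicClosure K) := by
    rw [mem_rootsOfUnity, ← map_pow, hξ.pow_eq_one, map_one]
  obtain ⟨k, hk, hkξ⟩ := hξ.eq_pow_of_mem_rootsOfUnity hσξ
  refine ⟨k, hk, fun ζ hζ => ?_⟩
  have hζmem : ζ ∈ rootsOfUnity N (AlgebraicClosure K) := by rwa [mem_rootsOfUnity]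
  obtain ⟨i, -, rfl⟩ := hξ.eq_pow_of_mem_rootsOfUnity hζmem
  rw [← hσu, map_pow, ← hkξ, ← pow_mul, ← pow_mul, mul_comm]

/-- Two exponents with which `μ_N(K̄)` can be raised to the same effect agree on EVERY element of exponent
dividing `N` of any monoid (they are congruent modulo `N`, tested on a primitive root) — bookkeeping for comparing
the exponent of an equivariance hypothesis with a cyclotomic character. [cite: MochizukiEtTh2009, §1 p.13] -/
theorem pow_eq_pow_of_forall_rootsOfUnity [CharZero K] (N : ℕ+) {k l : ℕ}
    (h : ∀ ζ : (AlgebraicClosure K)ˣ, ζ ^ (N : ℕ) = 1 → ζ ^ k = ζ ^ l) {M : Type*} [Monoid M] (y : M)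
    (hy : y ^ (N : ℕ) = 1) : y ^ k = y ^ l := by
  haveI : CharZero (AlgebraicClosure K) :=
    charZero_of_injective_algebraMap (algebraMap K (AlgebraicClosure K)).injective
  haveI : NeZero (N : ℕ) := ⟨N.ne_zero⟩
  obtain ⟨ξ₀, hξ₀⟩ := cyclotome.exists_isPrimitiveRoot_of_isSepClosed (AlgebraicClosure K) N N.pos
  have hξu : IsUnit ξ₀ := hξ₀.isUnit N.ne_zero
  have hξ : IsPrimitiveRoot hξu.unit (N : ℕ) := by
    rw [← IsPrimitiveRoot.coe_units_iff, hξu.unit_spec]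
    exact hξ₀
  have hmod : k % (N : ℕ) = l % (N : ℕ) := (cyclotome.pow_eq_pow_iff_mod_eq hξ k l).mp (h _ hξ.pow_eq_one)
  rw [pow_eq_pow_mod k hy, pow_eq_pow_mod l hy, hmod]

/-- **Tate-twist criterion from cyclotomically equivariant level maps** ([EtTh] p. 12 «`Ẑ(1)`», the body of
FACT-LIST F-1697).  Let `K` have characteristic `0`, `D : OncePuncturedTemperedGroup K`, `T ≤ A` a subgroup of a
topological group stable under an action `act` of `Π^tp_X`, and `λ_N : T →* ℤ/N` (`N ≥ 1`) homomorphisms that are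
surjective, with open kernels, compatible under reduction, jointly injective, and such that `λ_N (g · t) = k · λ_N t`
whenever `aug g` acts on the `N`-th roots of unity of `K̄` as the `k`-th power map.  Then `T` (with `act`) is a Tate
twist: the level maps `ι_N t := ξ_N ^ λ_N(t)` for a compatible system `ξ` of primitive roots of unity are torsion,
compatible, onto `μ_N(K̄)`, with `Ker ι_N = Ker λ_N` open, jointly injective, and equivariant because both sides of
the identity equal `ξ_N ^ (k · λ_N t)`. [cite: MochizukiEtTh2009, §1 p.12] -/
theorem isTateTwist_of_cyclotomicLevels [CharZero K] {A : Type} [Group A] [TopologicalSpace A] (T : Subgroup A)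
    (act : D.Pi → A →* A) (hact : ∀ g, ∀ t ∈ T, act g t ∈ T)
    (lam : ∀ N : ℕ+, T →* Multiplicative (ZMod N))
    (hsurj : ∀ N : ℕ+, Function.Surjective (lam N))
    (hopen : ∀ N : ℕ+, IsOpen ((lam N).ker : Set T))
    (hcompat : ∀ (N M : ℕ+) (t : T),
      (ZMod.castHom (dvd_mul_right (N : ℕ) M) (ZMod N)) (Multiplicative.toAdd (lam (N * M) t)) =
        Multiplicative.toAdd (lam N t))
    (hinj : ∀ t : T, (∀ N : ℕ+, lam N t = 1) → t = 1)
    (hequiv : ∀ (N : ℕ+) (g : D.Pi) (k : ℕ),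
      (∀ ζ : (AlgebraicClosure K)ˣ, ζ ^ (N : ℕ) = 1 →
        galApply (D.aug g) (ζ : AlgebraicClosure K) = ((ζ ^ k : (AlgebraicClosure K)ˣ) : AlgebraicClosure K)) →
      ∀ t : T, lam N ⟨act g t, hact g t t.2⟩ = lam N t ^ k) :
    D.IsTateTwist T act hact := by
  classical
  haveI : CharZero (AlgebraicClosure K) :=
    charZero_of_injective_algebraMap (algebraMap K (AlgebraicClosure K)).injective
  -- a compatible system of primitive roots of unity of `K̄`
  obtain ⟨ξ, hξ⟩ := cyclotome.exists_generator
    (cyclotome.exists_isPrimitiveRoot_of_isSepClosed (AlgebraicClosure K))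
  -- the level maps `ι'_N (t) := ξ_N ^ λ_N t`
  let ι' : ∀ N : ℕ+, ↥T →* (AlgebraicClosure K)ˣ := fun N =>
    { toFun := fun t => (ξ : ℕ+ → (AlgebraicClosure K)ˣ) N ^ (Multiplicative.toAdd (lam N t)).val
      map_one' := by rw [map_one, toAdd_one, ZMod.val_zero, pow_zero]
      map_mul' := fun s t => by
        rw [map_mul, toAdd_mul, ← pow_add]
        refine cyclotome.pow_val_eq_pow_of_mod_eq (cyclotome.pow_eq_one ξ N) ?_
        rw [ZMod.val_add, Nat.mod_mod] }
  have hι' : ∀ (N : ℕ+) (t : ↥T),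
      ι' N t = (ξ : ℕ+ → (AlgebraicClosure K)ˣ) N ^ (Multiplicative.toAdd (lam N t)).val := fun N t => rfl
  -- `ι'_N t = 1 ↔ λ_N t = 0`
  have hker : ∀ (N : ℕ+) (t : ↥T), ι' N t = 1 ↔ lam N t = 1 := by
    intro N t
    haveI : NeZero (N : ℕ) := ⟨N.ne_zero⟩
    rw [hι']
    constructor
    · intro h
      have hdvd := ((hξ N).pow_eq_one_iff_dvd _).mp h
      have hlt : (Multiplicative.toAdd (lam N t)).val < (N : ℕ) := ZMod.val_lt _
      have h0 : (Multiplicative.toAdd (lam N t)).val = 0 := Nat.eq_zero_of_dvd_of_lt hdvd hlt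
      rw [ZMod.val_eq_zero] at h0
      rw [← ofAdd_toAdd (lam N t), h0, ofAdd_zero]
    · intro h
      rw [h, toAdd_one, ZMod.val_zero, pow_zero]
  -- the `ℕ`-indexed family
  let ι : ℕ → (↥T →* (AlgebraicClosure K)ˣ) := fun n => if h : 0 < n then ι' (Nat.toPNat n h) else 1
  have hι : ∀ N : ℕ+, ι (N : ℕ) = ι' N := fun N => by
    simp only [ι, dif_pos N.pos]
    rfl
  have htors : ∀ (N : ℕ+) (t : ↥T), ι N t ^ (N : ℕ) = 1 := fun N t => by
    rw [hι, hι', pow_right_comm, cyclotome.pow_eq_one ξ N, one_pow]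
  refine ⟨ι, ?_, ?_, ?_, ?_, ?_, ?_⟩
  · intro n hn t
    obtain ⟨N, rfl⟩ : ∃ N : ℕ+, (N : ℕ) = n := ⟨Nat.toPNat n hn, rfl⟩
    exact htors N t
  · -- surjective onto `μ_n(K̄)`
    intro n hn ζ hζ
    obtain ⟨N, rfl⟩ : ∃ N : ℕ+, (N : ℕ) = n := ⟨Nat.toPNat n hn, rfl⟩
    haveI : NeZero (N : ℕ) := ⟨N.ne_zero⟩
    obtain ⟨i, hi, rfl⟩ := (hξ N).eq_pow_of_mem_rootsOfUnity (ξ := ζ) (by rwa [mem_rootsOfUnity])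
    obtain ⟨t, ht⟩ := hsurj N (Multiplicative.ofAdd (i : ZMod N))
    refine ⟨t, ?_⟩
    rw [hι, hι', ht, toAdd_ofAdd, ZMod.val_natCast, Nat.mod_eq_of_lt hi]
  · -- open kernels: `Ker ι_n = Ker λ_n`
    intro n hn
    obtain ⟨N, rfl⟩ : ∃ N : ℕ+, (N : ℕ) = n := ⟨Nat.toPNat n hn, rfl⟩
    have hset : ((ι N).ker : Set ↥T) = ((lam N).ker : Set ↥T) := by
      ext t
      rw [SetLike.mem_coe, SetLike.mem_coe, MonoidHom.mem_ker, MonoidHom.mem_ker, hι, hker]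
    rw [hset]
    exact hopen N
  · -- compatibility `(ι_{nm} t)^m = ι_n t`
    intro n m hn hm t
    obtain ⟨N, rfl⟩ : ∃ N : ℕ+, (N : ℕ) = n := ⟨Nat.toPNat n hn, rfl⟩
    obtain ⟨M, rfl⟩ : ∃ M : ℕ+, (M : ℕ) = m := ⟨Nat.toPNat m hm, rfl⟩
    haveI : NeZero (N : ℕ) := ⟨N.ne_zero⟩
    rw [← PNat.mul_coe, hι, hι, hι', hι', pow_right_comm, cyclotome.pow_apply_mul]
    refine cyclotome.pow_val_eq_pow_of_mod_eq (cyclotome.pow_eq_one ξ N) ?_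
    have hc := hcompat N M t
    rw [ZMod.castHom_apply, ZMod.cast_eq_val] at hc
    rw [← hc, ZMod.val_natCast]
    exact (Nat.mod_mod _ _).symm
  · -- jointly injective
    intro t ht
    refine hinj t fun N => ?_
    rw [← hker, ← hι]
    exact ht N N.pos
  · -- equivariance: `aug g` acts on `μ_N(K̄)` as `ζ ↦ ζ^k`, and `λ_N (g·t) = k·λ_N t`
    intro n hn g t
    obtain ⟨N, rfl⟩ : ∃ N : ℕ+, (N : ℕ) = n := ⟨Nat.toPNat n hn, rfl⟩
    haveI : NeZero (N : ℕ) := ⟨N.ne_zero⟩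
    obtain ⟨k, -, hk⟩ := exists_pow_eq_galApply_of_pow_eq_one (D.aug g) N
    have hlam : lam N ⟨act g t, hact g t t.2⟩ = lam N t ^ k := hequiv N g k hk t
    -- right-hand side: `σ (ξ_N ^ v) = ξ_N ^ (k v)`
    rw [hι, hι', hι', hlam, hk _ (by rw [pow_right_comm, cyclotome.pow_eq_one ξ N, one_pow]), ← pow_mul,
      Units.ext_iff.mp (cyclotome.pow_val_eq_pow_of_mod_eq (a := (ξ : ℕ+ → (AlgebraicClosure K)ˣ) N)
        (cyclotome.pow_eq_one ξ N) (k := (Multiplicative.toAdd (lam N t ^ k)).val)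
        (l := (Multiplicative.toAdd (lam N t)).val * k) ?_)]
    rw [toAdd_pow, nsmul_eq_mul, ZMod.val_mul, ZMod.val_natCast, Nat.mod_mod, Nat.mul_mod, Nat.mod_mod,
      ← Nat.mul_mod, mul_comm]

end OncePuncturedTemperedGroup

end Literature.AnabelianGeometry.SemiGraphs

end
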